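import Summits.QuantumFields.GaugeBoot.InvariantSchwingerDysonRows
import Summits.QuantumFields.GaugeBoot.SchwingerDysonDeterminesWilson
import HarnessLib

/-!
# Loop equations along CENTRAL directions: gauge-invariant test functions suffice; `U(1)` completeness in finite volume (gauge-boot, L1 supplement)

HONEST FRAMING (cell `pub-gaugeboot`, page 1 of every file): the venture produces certified bounds
on lattice expectations at stated coupling, gauge group, dimension and torus size; NOT a mass gap,
NOT a continuum limit, NOT a string tension; NOT Yang–Mills-summit-bearing (barriers
`FixedCouplingUltralocality`, `PerturbativeInvisibility`). This module is a structural statement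
about the finite-volume Wilson theory; it certifies no number.

## Content

The gauge group `Λ → G` of the torus `Λ = (ℤ/L)^d` acts on configurations by
`gaugeTransform g U (x,i) = g(x) U(x,i) g(x+eᵢ)⁻¹` (Wave 0). A one-link shift `U ↦ U[e ↦ z U_e]`
COMMUTES with every gauge transformation exactly when `z` is CENTRAL
(`gaugeTransform_update_mul_of_central`). Hence (`InvariantSchwingerDysonRows.lean` with
`H` = the gauge group):

* ★★ `eq_wilsonMeasure_iff_sdOn_gaugeInvariant` — torus, `G` compact metrisable, `ρ` continuous,
  ANY real `β`, a family of continuous CENTRAL one-parameter subgroups exhausting `G` (so `G` is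
  abelian) along which the Wilson action is differentiable: a GAUGE-INVARIANT probability measure
  satisfies the Schwinger–Dyson rows for the GAUGE-INVARIANT test functions iff it is Wilson's
  measure;
* ★★★ `integral_eq_wilson_of_sdOn_gaugeInvariant` — same data, ANY probability measure `μ`
  (no invariance assumed): the rows for gauge-invariant test functions force
  `∫ F dμ = ∫ F dμ_Wilson` for EVERY gauge-invariant continuous `F`; the gauge average of `μ` IS
  Wilson's measure (`avgMeasure_eq_wilsonMeasure_of_sdOn_gaugeInvariant`);
* ★★★ `eq_wilsonMeasure_iff_sdOn_gaugeInvariant_u1`, ★★★ `integral_eq_wilson_of_sdOn_gaugeInvariant_u1`,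
  `avgMeasure_eq_wilsonMeasure_of_sdOn_gaugeInvariant_u1` — UNCONDITIONAL for compact `U(1)`
  lattice gauge theory on `(ℤ/L)^d`, every `d`, `L ≥ 1`, every real `β`, along the exponential
  shifts `U ↦ U[e ↦ e^{tX} U_e]`, `X ∈ 𝔲(1) = iℝ`: THE `U(1)` LOOP EQUATIONS WITH GAUGE-INVARIANT TEST
  FUNCTIONS, TOGETHER WITH REALISABILITY BY A PROBABILITY MEASURE, DETERMINE EVERY GAUGE-INVARIANT
  EXPECTATION IN FINITE VOLUME — the finite-volume answer to the question studied numerically in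
  Li–Zhou, arXiv:2404.17071 ("whether the constraints from loop equations and positivity are strong
  enough to solve [the abelian] lattice gauge theories");
* ★★ `isSchwingerDysonStateOn_gaugeInvariant_iff_of_central` — any `G`, any local actions: for a
  gauge-invariant finite measure the rows along a CENTRAL family with gauge-invariant test
  functions are equivalent to the same rows with ALL test functions (e.g. the `U(1)` factor
  `t ↦ e^{it}·1` of `U(N)`).

Contrast (`AdInvariantSchwingerDysonRows.lean`, lean3 gen 72): along TRACELESS directions of
`SU(N)` / `U(N)` the rows with conjugation-invariant (a fortiori gauge-invariant) test functions are
`0 = β·0` and determine nothing. Central directions: everything (abelian case); traceless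
directions: nothing — the information of the non-abelian loop equations sits in the covariant
matrix-valued test functions.

References: Z. Li, S. Zhou, arXiv:2404.17071 §1–2, §4; P. Anderson, M. Kruczenski, Nucl. Phys. B
921 (2017) §2; M. Creutz, *Quarks, gluons and lattices* (1983) Ch. 11. Folklore (no printed
finite-volume completeness statement was found).
-/

noncomputable section

open MeasureTheory
open Literature.MathematicalPhysics.QuantumFieldTheory (haarProbability Site Edge GaugeConfig
  gaugeTransform IsGaugeInvariant wilsonAction wilsonMeasure wilsonAction_gaugeTransform
  continuous_wilsonAction_of_continuous isProbabilityMeasure_wilsonMeasure)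
open Literature.MathematicalPhysics.QuantumLattice (wilsonMeasure_eq_tilted_pi unitaryFundamentalRep
  continuous_unitaryFundamentalRep)

namespace Summit.QuantumFields.GaugeBoot

/-! ## The gauge group action on the torus -/

section GaugeGroup

variable {d L : ℕ} {G : Type*} [Group G]

/-- **One-link shifts by CENTRAL elements commute with gauge transformations**:
`(U[e ↦ z U_e])^g = (U^g)[e ↦ z (U^g)_e]` when `z` commutes with every element of `G`. [folklore] -/
theorem gaugeTransform_update_mul_of_central {z : G} (hz : ∀ g : G, g * z = z * g)
    (h : Site d L → G) (U : GaugeConfig d L G) (e : Edge d L) :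
    gaugeTransform h (Function.update U e (z * U e)) =
      Function.update (gaugeTransform h U) e (z * gaugeTransform h U e) := by
  funext e'
  by_cases he : e' = e
  · subst he
    simp only [gaugeTransform, Function.update_self]
    rw [← mul_assoc (h e'.1) z, hz (h e'.1), mul_assoc z, mul_assoc z]
  · simp only [gaugeTransform, Function.update_of_ne he]

variable [TopologicalSpace G] [IsTopologicalGroup G]

/-- **The gauge action of the torus is a jointly continuous group action** — the two inputs
`hmul`, `hact` of `InvariantSchwingerDysonRows.lean` in one package: `U^{g g'} = (U^{g'})^{g}` and
`(g, U) ↦ U^g` is continuous. (The two components are elementary; they also occur, separately, in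
the `YangMills` route file `…SusceptibilityToPoincareOrbitSliceSplit` — packaged here so that the
cell's modules do not depend on a crux-line file of another route.) [folklore] -/
theorem gaugeTransform_action :
    (∀ (g g' : Site d L → G) (U : GaugeConfig d L G),
        gaugeTransform (g * g') U = gaugeTransform g (gaugeTransform g' U)) ∧
      Continuous fun p : (Site d L → G) × GaugeConfig d L G => gaugeTransform p.1 p.2 := by
  refine ⟨fun g g' U => funext fun e => ?_, continuous_pi fun e => ?_⟩
  · simp only [gaugeTransform, Pi.mul_apply, mul_inv_rev, mul_assoc]
  · exact ((((continuous_apply e.1).comp continuous_fst).mul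
      ((continuous_apply e).comp continuous_snd)).mul
      (((continuous_apply (e.1.shift e.2)).comp continuous_fst).inv))

end GaugeGroup

/-! ## The torus: central families -/

section Torus

variable {d L N : ℕ} {G : Type*} [Group G] [TopologicalSpace G] [IsTopologicalGroup G]
  [CompactSpace G] [MeasurableSpace G] [BorelSpace G] [T2Space G] [SecondCountableTopology G]
  [Nonempty G] (ρ : G →* Matrix (Fin N) (Fin N) ℂ) {K : Type*} {k : K → ℝ → G}

/-- ★★ **Torus, gauge-invariant state, CENTRAL family exhausting `G`: rows for gauge-invariant test
functions ⇔ Wilson's measure.** `G` compact metrisable, `ρ` continuous, ANY real `β`; `k a`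
continuous central one-parameter subgroups with every `g ∈ G` some `k a t`, the Wilson action
differentiable along them with continuous derivative (`hSd`). A gauge-invariant probability measure
on `GaugeConfig d L G` satisfies the Schwinger–Dyson rows `∫ f' dμ = β ∫ f S' dμ` for every
GAUGE-INVARIANT test function `f` iff `μ = wilsonMeasure ρ β`. [folklore] -/
theorem eq_wilsonMeasure_iff_sdOn_gaugeInvariant [NeZero L] (hkc : ∀ a, Continuous (k a))
    (hk : ∀ a s t, k a (s + t) = k a s * k a t) (hG : ∀ g : G, ∃ a t, k a t = g)
    (hcen : ∀ (a : K) (t : ℝ) (g : G), g * k a t = k a t * g) (hρ : Continuous ρ)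
    (hSd : ∀ (e : Edge d L) (a : K), ∃ S' : GaugeConfig d L G → ℝ, Continuous S' ∧
      ∀ U, HasDerivAt (fun t => wilsonAction ρ (Function.update U e (k a t * U e))) (S' U) 0)
    (β : ℝ) (μ : Measure (GaugeConfig d L G)) [IsProbabilityMeasure μ]
    (hμinv : ∀ g : Site d L → G, μ.map (gaugeTransform g) = μ) :
    μ = wilsonMeasure ρ β ↔
      IsSchwingerDysonStateOn IsGaugeInvariant k (fun _ => wilsonAction ρ) β μ := by
  rw [wilsonMeasure_eq_tilted_pi ρ hρ β]
  exact eq_pi_tilted_iff_sdOn_invariant hkc hk hG (continuous_wilsonAction_of_continuous ρ hρ) hSd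
    (P := IsGaugeInvariant) (act := gaugeTransform) (fun _ hf => hf) gaugeTransform_action.1
    gaugeTransform_action.2
    (fun h e a t U => gaugeTransform_update_mul_of_central (hcen a t) h U e)
    (fun h U => wilsonAction_gaugeTransform ρ h U) β μ hμinv

/-- ★★★ **Torus, ANY state, central family exhausting `G`: the rows for gauge-invariant test
functions determine every gauge-invariant expectation.** Same data as
`eq_wilsonMeasure_iff_sdOn_gaugeInvariant`, but `μ` is ANY probability measure (no invariance
assumed): if `μ` satisfies the Schwinger–Dyson rows for the gauge-invariant test functions, then
`∫ F dμ = ∫ F dμ_Wilson` for every gauge-invariant continuous observable `F`. [folklore] -/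
theorem integral_eq_wilson_of_sdOn_gaugeInvariant [NeZero L] (hkc : ∀ a, Continuous (k a))
    (hk : ∀ a s t, k a (s + t) = k a s * k a t) (hG : ∀ g : G, ∃ a t, k a t = g)
    (hcen : ∀ (a : K) (t : ℝ) (g : G), g * k a t = k a t * g) (hρ : Continuous ρ) {β : ℝ}
    {μ : Measure (GaugeConfig d L G)} [IsProbabilityMeasure μ]
    (hμ : IsSchwingerDysonStateOn IsGaugeInvariant k (fun _ => wilsonAction ρ) β μ)
    (F : GaugeConfig d L G → ℝ) (hF : Continuous F) (hFi : IsGaugeInvariant F) :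
    ∫ U, F U ∂μ = ∫ U, F U ∂(wilsonMeasure ρ β) := by
  rw [wilsonMeasure_eq_tilted_pi ρ hρ β]
  exact integral_eq_pi_tilted_of_sdOn_invariant hkc hk hG (continuous_wilsonAction_of_continuous ρ hρ)
    (act := gaugeTransform) gaugeTransform_action.1 gaugeTransform_action.2
    (fun h e a t U => gaugeTransform_update_mul_of_central (hcen a t) h U e)
    (fun h U => wilsonAction_gaugeTransform ρ h U) hμ F hF hFi

/-- ★★★ **Torus, ANY state, central family: the gauge average of a solution of the gauge-invariant
rows IS Wilson's measure.** [folklore] -/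
theorem avgMeasure_eq_wilsonMeasure_of_sdOn_gaugeInvariant [NeZero L] (hkc : ∀ a, Continuous (k a))
    (hk : ∀ a s t, k a (s + t) = k a s * k a t) (hG : ∀ g : G, ∃ a t, k a t = g)
    (hcen : ∀ (a : K) (t : ℝ) (g : G), g * k a t = k a t * g) (hρ : Continuous ρ) {β : ℝ}
    {μ : Measure (GaugeConfig d L G)} [IsProbabilityMeasure μ]
    (hμ : IsSchwingerDysonStateOn IsGaugeInvariant k (fun _ => wilsonAction ρ) β μ) :
    avgMeasure (gaugeTransform (d := d) (L := L) (G := G)) μ = wilsonMeasure ρ β := by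
  rw [wilsonMeasure_eq_tilted_pi ρ hρ β]
  exact avgMeasure_eq_pi_tilted_of_sdOn_invariant hkc hk hG (continuous_wilsonAction_of_continuous ρ hρ)
    (act := gaugeTransform) gaugeTransform_action.1 gaugeTransform_action.2
    (fun h e a t U => gaugeTransform_update_mul_of_central (hcen a t) h U e)
    (fun h U => wilsonAction_gaugeTransform ρ h U) hμ

/-- Wilson's measure satisfies the rows of every class of test functions (central or not), for
every family of continuous one-parameter subgroups exhausting `G` along which the Wilson action is
differentiable. [folklore] -/
theorem wilsonMeasure_sdOn [NeZero L] (hkc : ∀ a, Continuous (k a))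
    (hk : ∀ a s t, k a (s + t) = k a s * k a t) (hG : ∀ g : G, ∃ a t, k a t = g)
    (hρ : Continuous ρ)
    (hSd : ∀ (e : Edge d L) (a : K), ∃ S' : GaugeConfig d L G → ℝ, Continuous S' ∧
      ∀ U, HasDerivAt (fun t => wilsonAction ρ (Function.update U e (k a t * U e))) (S' U) 0)
    (β : ℝ) (P : (GaugeConfig d L G → ℝ) → Prop) :
    IsSchwingerDysonStateOn P k (fun _ => wilsonAction ρ) β (wilsonMeasure ρ β) := by
  haveI := isProbabilityMeasure_wilsonMeasure (d := d) (L := L) ρ hρ β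
  exact ((eq_wilsonMeasure_iff_sd ρ hkc hk hG hρ hSd β _).1 rfl).on P

end Torus

/-! ## Compact `U(1)` lattice gauge theory: the loop equations are complete in finite volume -/

section U1

variable {d L : ℕ}

/-- `U(1)` is abelian: `1 × 1` unitary matrices commute. [folklore] -/
theorem unitaryGroup_fin_one_comm (g z : Matrix.unitaryGroup (Fin 1) ℂ) : g * z = z * g := by
  refine Subtype.ext (Matrix.ext fun i j => ?_)
  change ((g : Matrix (Fin 1) (Fin 1) ℂ) * (z : Matrix (Fin 1) (Fin 1) ℂ)) i j =
    ((z : Matrix (Fin 1) (Fin 1) ℂ) * (g : Matrix (Fin 1) (Fin 1) ℂ)) i j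
  fin_cases i; fin_cases j
  simp [Matrix.mul_apply, mul_comm]

/-- ★★★ **`U(1)` ON THE TORUS, GAUGE-INVARIANT STATE: the gauge-invariant loop equations hold iff
the state is Wilson's measure.** Compact `U(1)` lattice gauge theory (fundamental charge) on
`(ℤ/L)^d`, every `d`, `L ≥ 1`, every real `β`: a gauge-invariant probability measure satisfies the
one-link Schwinger–Dyson identities `∫ f' dμ = β ∫ f S' dμ` along `U ↦ U[e ↦ e^{tX} U_e]`,
`X ∈ 𝔲(1)`, for every GAUGE-INVARIANT test function `f` iff it is `wilsonMeasure`. UNCONDITIONAL.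
[folklore] -/
theorem eq_wilsonMeasure_iff_sdOn_gaugeInvariant_u1 [NeZero L] (β : ℝ)
    (μ : Measure (GaugeConfig d L (Matrix.unitaryGroup (Fin 1) ℂ))) [IsProbabilityMeasure μ]
    (hμinv : ∀ g : Site d L → Matrix.unitaryGroup (Fin 1) ℂ, μ.map (gaugeTransform g) = μ) :
    μ = wilsonMeasure (unitaryFundamentalRep (Fin 1) ℂ) β ↔
      IsSchwingerDysonStateOn IsGaugeInvariant (uExp 1)
        (fun _ => wilsonAction (unitaryFundamentalRep (Fin 1) ℂ)) β μ :=
  eq_wilsonMeasure_iff_sdOn_gaugeInvariant (unitaryFundamentalRep (Fin 1) ℂ) (continuous_uExp 1)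
    (uExp_add 1) (fun g => exists_uExp_eq 1 g) (fun _ _ g => unitaryGroup_fin_one_comm g _)
    (continuous_unitaryFundamentalRep _ _) (fun e X => exists_hasDerivAt_wilsonAction_uExp 1 e X)
    β μ hμinv

/-- ★★★ **`U(1)` ON THE TORUS, ANY STATE: THE GAUGE-INVARIANT LOOP EQUATIONS PLUS REALISABILITY BY A
PROBABILITY MEASURE DETERMINE EVERY GAUGE-INVARIANT EXPECTATION.** Compact `U(1)` lattice gauge
theory on `(ℤ/L)^d`, every `d`, `L ≥ 1`, every real `β`: if a probability measure `μ` on the gauge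
configurations satisfies the one-link Schwinger–Dyson identities along `U ↦ U[e ↦ e^{tX} U_e]`,
`X ∈ 𝔲(1)`, for every gauge-invariant test function, then `∫ F dμ = ∫ F dμ_Wilson` for every
gauge-invariant continuous observable `F` (every Wilson loop, every product of Wilson loops, …).
UNCONDITIONAL. [folklore] -/
theorem integral_eq_wilson_of_sdOn_gaugeInvariant_u1 [NeZero L] {β : ℝ}
    {μ : Measure (GaugeConfig d L (Matrix.unitaryGroup (Fin 1) ℂ))} [IsProbabilityMeasure μ]
    (hμ : IsSchwingerDysonStateOn IsGaugeInvariant (uExp 1)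
      (fun _ => wilsonAction (unitaryFundamentalRep (Fin 1) ℂ)) β μ)
    (F : GaugeConfig d L (Matrix.unitaryGroup (Fin 1) ℂ) → ℝ) (hF : Continuous F)
    (hFi : IsGaugeInvariant F) :
    ∫ U, F U ∂μ = ∫ U, F U ∂(wilsonMeasure (unitaryFundamentalRep (Fin 1) ℂ) β) :=
  integral_eq_wilson_of_sdOn_gaugeInvariant (unitaryFundamentalRep (Fin 1) ℂ) (continuous_uExp 1)
    (uExp_add 1) (fun g => exists_uExp_eq 1 g) (fun _ _ g => unitaryGroup_fin_one_comm g _)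
    (continuous_unitaryFundamentalRep _ _) hμ F hF hFi

/-- ★★★ **`U(1)` on the torus, any state: the gauge average of a probability solution of the
gauge-invariant loop equations is Wilson's measure.** [folklore] -/
theorem avgMeasure_eq_wilsonMeasure_of_sdOn_gaugeInvariant_u1 [NeZero L] {β : ℝ}
    {μ : Measure (GaugeConfig d L (Matrix.unitaryGroup (Fin 1) ℂ))} [IsProbabilityMeasure μ]
    (hμ : IsSchwingerDysonStateOn IsGaugeInvariant (uExp 1)
      (fun _ => wilsonAction (unitaryFundamentalRep (Fin 1) ℂ)) β μ) :
    avgMeasure (gaugeTransform (d := d) (L := L) (G := Matrix.unitaryGroup (Fin 1) ℂ)) μ =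
      wilsonMeasure (unitaryFundamentalRep (Fin 1) ℂ) β :=
  avgMeasure_eq_wilsonMeasure_of_sdOn_gaugeInvariant (unitaryFundamentalRep (Fin 1) ℂ)
    (continuous_uExp 1) (uExp_add 1) (fun g => exists_uExp_eq 1 g)
    (fun _ _ g => unitaryGroup_fin_one_comm g _) (continuous_unitaryFundamentalRep _ _) hμ

/-- `U(1)`, torus: Wilson's measure does satisfy the gauge-invariant rows (and all others).
[folklore] -/
theorem wilsonMeasure_sdOn_gaugeInvariant_u1 [NeZero L] (β : ℝ) :
    IsSchwingerDysonStateOn IsGaugeInvariant (uExp 1)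
      (fun _ => wilsonAction (unitaryFundamentalRep (Fin 1) ℂ)) β
      (wilsonMeasure (d := d) (L := L) (unitaryFundamentalRep (Fin 1) ℂ) β) :=
  wilsonMeasure_sdOn (unitaryFundamentalRep (Fin 1) ℂ) (continuous_uExp 1) (uExp_add 1)
    (fun g => exists_uExp_eq 1 g) (continuous_unitaryFundamentalRep _ _)
    (fun e X => exists_hasDerivAt_wilsonAction_uExp 1 e X) β IsGaugeInvariant

end U1

/-! ## Any gauge group: along a central family the gauge-invariant rows are all the rows -/

section Central

variable {d L : ℕ} {G : Type*} [Group G] [TopologicalSpace G] [IsTopologicalGroup G]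
  [CompactSpace G] [MeasurableSpace G] [BorelSpace G] [SecondCountableTopology G]
  {K : Type*} {k : K → ℝ → G} {S : Edge d L → GaugeConfig d L G → ℝ} {β : ℝ}

/-- ★★ **Along a CENTRAL family, for a gauge-invariant state, the rows with gauge-invariant test
functions are equivalent to the rows with ALL test functions.** Torus `(ℤ/L)^d`, `G` compact
metrisable (any — e.g. `U(N)` with the central family `t ↦ e^{it}·1`), `k a` continuous central
one-parameter subgroups (NOT assumed to exhaust `G`), gauge-invariant continuous local actions
`S e`, `μ` a gauge-invariant finite measure. Proof: invariant rows ⇒ Haar-shift identity along the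
family for invariant observables (`…integral_comp_update_mul_of_invariant`) ⇒ for all observables
(`haarShift_of_forall_invariant`) ⇒ rows for all test functions (differentiation at `t = 0`,
`FlowSchwingerDyson`). [folklore] -/
theorem isSchwingerDysonStateOn_gaugeInvariant_iff_of_central [NeZero L] (hkc : ∀ a, Continuous (k a))
    (hk : ∀ a s t, k a (s + t) = k a s * k a t)
    (hcen : ∀ (a : K) (t : ℝ) (g : G), g * k a t = k a t * g) (hS : ∀ e, Continuous (S e))
    (hSinv : ∀ (g : Site d L → G) (e : Edge d L) (U : GaugeConfig d L G),
      S e (gaugeTransform g U) = S e U)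
    (μ : Measure (GaugeConfig d L G)) [IsFiniteMeasure μ]
    (hμinv : ∀ g : Site d L → G, μ.map (gaugeTransform g) = μ) :
    IsSchwingerDysonStateOn IsGaugeInvariant k S β μ ↔ IsSchwingerDysonState k S β μ := by
  refine ⟨fun hμ e a => ?_, fun h => h.on IsGaugeInvariant⟩
  obtain ⟨S', hS'c, hS', -⟩ := hμ e a
  refine ⟨S', hS'c, hS', fun f f' hf hf' hd => ?_⟩
  refine (isContinuousFlow_update_mul (hkc a) (hk a) e).sd_of_forall_integral_comp_flow_eq_integral_mul_exp
    μ (hS e) hS'c hS' β (fun F hF τ => ?_) hf hf' hd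
  have hcomm : ∀ (t : ℝ) (h : Site d L → G) (U : GaugeConfig d L G),
      gaugeTransform h (Function.update U e (k a t * U e)) =
        Function.update (gaugeTransform h U) e (k a t * gaugeTransform h U e) :=
    fun t h U => gaugeTransform_update_mul_of_central (hcen a t) h U e
  have h1 := haarShift_of_forall_invariant (S := S) (β := β) (act := gaugeTransform)
    gaugeTransform_action.1 gaugeTransform_action.2 hμinv e (k a τ) (hcomm τ)
    (fun h U => by simpa only [update_oneParam_neg (hk a)] using hcomm (-τ) h U)
    (fun h U => hSinv h e U) (hS e)
    (fun F hF hFi => hμ.integral_comp_update_mul_of_invariant hkc hk hS (P := IsGaugeInvariant)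
      (fun _ hf => hf) e a (fun h t U => hcomm t h U) (fun h U => hSinv h e U) τ F hF hFi) F hF
  simpa only [update_oneParam_neg (hk a)] using h1

end Central

end Summit.QuantumFields.GaugeBoot

end
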